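import Literature.MathematicalPhysics.QuantumFieldTheory.Volkov2017.GenerationAlgorithmLaw
import Literature.MathematicalPhysics.QuantumFieldTheory.Borinsky2020.TropicalSamplingEstimator
import Literature.Probability.HeavyTails.CentralLimitNecessity
import HarnessLib

/-!
# PRD 96 §III.A for the printed algorithm: the output law as a probability MEASURE, the estimate `(1/N) Σ f(x_j)/g(x_j)`, its standard
deviation `σ = √(V(f,g)/N)` (eq. (13)) and the three cases — PROVED

independent recomputation; certified where stated, statistical where stated; no new-physics claim.

CITATION HEADER (venture `QEDPrecision`, cell `pub-qed`, track TROPICAL seat V3a = `pub-qed-trop-v3-lit-1` gen 14; VALUE-FREE: identities and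
limit theorems in the symbols `Deg(s) > 0`, `f`, `N`; no constant, nothing per graph, per word or per Set V family). Fifth file of the chain
`FastSamplingTable` → `SectorIntegral` / `SumToMaxLemma` → `WholeSimplexIntegral` → `GenerationAlgorithmLaw` (the law of "The algorithm" as
the identity `Σ_σ genProb(σ) • ∫ φ(output) dr = ∫_{simplex} g • φ` for every test function; listed there as NOT typed: "the statement as an
identity of MEASURES"). This file (i) puts that law in Mathlib's probabilistic vocabulary — a probability measure `outputLaw` on the chart and a
`HasLaw` statement for the output of one run — and (ii) types §III.A's sentences about the `N`-sample estimate as theorems about THIS sampler: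
unbiasedness, eq. (13) `σ = √(V(f,g)/N)`, convergence, and the trichotomy "bounded / `V` finite / `V` infinite", by instantiating the
i.i.d. theory already in the tree (`Borinsky2020/TropicalSamplingEstimator`: mean, variance, Chebyshev, CLT, strong law, Hoeffding for an
i.i.d. importance-sampling estimator; `Probability/HeavyTails/CentralLimitNecessity`: a finite variance is NECESSARY for any `√N` limit law).
Serves `tropical/view/V3-VOLKOV-DEGREES.md` §A A.0.4 / A.5 / A.32–A.33 (item (a″) "the law as an identity of MEASURES … in Mathlib's
`IdentDistrib`/CLT vocabulary").

Source [Volkov2017]: S. Volkov, Phys. Rev. D 96, 096018 (2017) = arXiv:1705.05800v4 (e-print `amm4_mc_arxiv.tex` held on the cell's HOME under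
`data/lit/sources/.cache/1705.05800/`, sha256 3d5fd6a7…; §III.A = p.10 of the latest arXiv PDF (33 pp.; page dump under
`data/lit/sources/.cache/arxiv-pdf-pages/1705.05800/`), §III.B eq. (16) = p.11, §III.C = p.17–18; equation numbers counted from the numbered
`equation` environments AND read off that PDF — `eq_sigma` = (13): the PDF prints «The standard deviation of this value is … (13)»; NOTE
`GenerationAlgorithmLaw`'s docstrings write «(14)» for this same label, a locator slip recorded in `tropical/view/V3-VOLKOV-DEGREES.md` A.34;
the LaTeX label is unambiguous), VERBATIM:
* §III.A "Importance Sampling" (tex l.491–511): "For integration of a function f(x) = f(x₁,…,x_n) over Ω using Monte-Carlo approach with the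
  probability density function g(x), ∫_Ω g(x) dx = 1, we take randomly N samples x₁,…,x_N with the distribution g and approximate the needed
  integral by (1/N) Σ_{j=1}^{N} f(x_j)/g(x_j). The standard deviation of this value is (13) [`eq_sigma`] σ = √(V(f,g)/N), where
  V(f,g) = ∫_Ω f(x)²/g(x) dx − (∫_Ω f(x) dx)², see [mc_james]."
* §III.A, the three cases (tex l.513–532): "For a given function g(x) we may have one of the following three situations. 1. The function
  f(x)/g(x) is bounded. In this case, we will have a stable Monte Carlo convergence with the error that can be approximated by (13). However,
  the convergence may be slow due to the big value of V(f,g). 2. The function f(x)/g(x) is unbounded, but V(f,g) is finite. In this case, the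
  error can be approximated by (13) too. However, the convergence can be unstable. We should use some techniques for stabilization and
  adequate error estimation. 3. V(f,g) is infinite. In this case, we will have unstable convergence that is slower than C/√N. An adequate error
  estimation is difficult in this case."
* §III.B (tex l.594–599): "The probability density function is defined by g(z₁,…,z_n) = g₀(z₁,…,z_n)/∫_{z₁,…,z_n>0} g₀(z₁,…,z_n)
  δ(z₁+…+z_n−1) dz₁…dz_n."; §III.C "The algorithm" (tex l.984–1008): "Generation part. 1. Generation of a sector. for l := 1 to n do put
  j_l = a with the probability P[Λ∖{j₁,…,j_{l−1}}, a]; 2. Generation of a point. Generate r₂,…,r_n ∈ [0;1] using the uniform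
  distribution. Put t_l = r_l^{1/Deg({j_l,…,j_n})} … Calculate z₁,…,z_n using (21)."

What is typed (all PROVED; Mathlib + the tree files imported). Conventions = `GenerationAlgorithmLaw`: `n = m + 2` lines, chart
`x = (z₂,…,z_n) ∈ ℝ^{n−1}`, `z = simplexPoint x = (1 − Σ x, x)`, open simplex = `simplexChart m`, `g = samplingDensity Deg`, Generation part 2 for
the sector `σ` = `genPointSector Deg σ r` on the uniform box `r ∈ Borinsky2020.heppUnitBox m`, sector law `FastSamplingTable.genProb`.
* §1 MEASURABILITY (plumbing the prints leave implicit): `measurable_g0Fund`; `measurableSet_sectorPerm_eq` (the level sets `{z | σ(z) = σ}`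
  of the decreasing sort are finite Boolean combinations of coordinate (in)equalities — Mathlib's `Tuple.eq_sort_iff`); `g0Simplex_eq_sum_ite`,
  **`measurable_g0Simplex`**, `measurable_simplexPoint`, **`measurable_samplingDensity`**; `measurable_rpowVec`, `measurable_pointFromSectorVars`,
  **`measurable_genPointSector`**.
* §2 THE LAW AS A MEASURE: `outputLaw Deg = (volume.restrict simplexChart).withDensity (ofReal ∘ g)` (def) — "the distribution g" on
  `{z > 0, Σ z = 1}` read in the chart; `outputLaw_apply` (mass of `A` = `∫⁻_{A ∩ simplex} g`), `integrableOn_samplingDensity`,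
  **`isProbabilityMeasure_outputLaw`** ("∫_Ω g(x) dx = 1"), **`integral_outputLaw`** (`E_g[φ] = ∫_{simplex} g • φ`, every Banach-valued `φ`),
  `integrable_outputLaw_iff`, `ae_mem_simplexChart_outputLaw`.
* §3 THE WEIGHT `f/g` OF ONE DRAW: `weight Deg f = f/g` (def), `measurable_weight`; `samplingVariance Deg f = ∫_{simplex} f²/g − (∫_{simplex} f)²`
  (def; the printed `V(f,g)` with `Ω` = the simplex); **`integral_weight`** (`E_g[f/g] = ∫ f`), `integrable_weight_iff` (`f/g ∈ L¹(g) ⇔ f ∈ L¹`),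
  **`integral_weight_sq`** (`E_g[(f/g)²] = ∫ f²/g`), `integrable_weight_sq_iff` / `memLp_two_weight_iff` (`f/g ∈ L²(g) ⇔ f²/g ∈ L¹`),
  `integrableOn_of_integrableOn_sq_div` (finite `V(f,g)` forces a finite mean: `|f| ≤ (f²/g + g)/2`), and **`variance_weight`**:
  `Var_g[f/g] = V(f,g)` — `V(f,g)` of eq. (13) IS the variance of one draw.
* §4 THE ALGORITHM HAS THIS LAW: `volume_heppUnitBox = 1`, `isProbabilityMeasure_volume_restrict_heppUnitBox`, `genProb_ofFn_pos`, and
  **`hasLaw_genPointSector`**: on any probability space, if the sector `S` and the uniform numbers `r` of one run have the printed joint law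
  `P(S = σ, r ∈ B) = genProb(σ) · Unif(B)` (Generation part 1's law (24) × independent uniform `r`), then the returned chart point
  `genPointSector Deg (S ω) (r ω)` `HasLaw` `outputLaw Deg` under `P` — the measure form of `GenerationAlgorithmLaw`'s headline theorem (tested
  on indicators of measurable sets and summed over the finitely many sectors).
* §5 `N` SAMPLES (a stream `x : ℕ → Ω → chart` of independent draws, `x 0` of law `outputLaw`, identically distributed — "we take randomly N
  samples … with the distribution g"; by §4 this is what `N` independent runs of the algorithm produce): `mcEstimate Deg f x N =
  (1/N) Σ_{j<N} f(x_j)/g(x_j)` (def), `mcEstimate_eq_tropicalEstimate` (it is `Borinsky2020.tropicalEstimate 1 (f/g)` — the dictionary to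
  the tree's i.i.d. estimator theory), `sqrt_mul_mcEstimate_sub`; then, for measurable `f`:
  - **`integral_mcEstimate`**: `E[estimate] = ∫_{simplex} f` (`N ≥ 1`, `f ∈ L¹`): the printed estimate is unbiased;
  - **`variance_mcEstimate`**: `Var[estimate] = V(f,g)/N` and **`sqrt_variance_mcEstimate`**: `√Var = √(V(f,g)/N)` — eq. (13) AS PRINTED,
    for `N ≥ 1` and `f²/g ∈ L¹(simplex)` (cases 1–2); `measureReal_le_abs_mcEstimate_sub`: `P(|estimate − ∫f| ≥ δ) ≤ V(f,g)/(Nδ²)` (the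
    Chebyshev content of "the error can be approximated by (13)");
  - **`ae_tendsto_mcEstimate`**: `estimate_N → ∫ f` almost surely whenever `f ∈ L¹(simplex)` — the "convergence" of ALL three cases needs only
    the finite MEAN (absolute convergence of the subtracted integral), not `V(f,g) < ∞`;
  - **`tendstoInDistribution_mcEstimate`**: cases 1–2 — `√N (estimate_N − ∫ f) ⇒ 𝒩(0, V(f,g))` (Mathlib's central limit theorem): `σ` of (13) is
    the asymptotic error scale; `measureReal_le_abs_mcEstimate_sub_le_exp_of_bounded`: case 1 (`|f| ≤ C g`) — `P(|estimate − ∫f| ≥ δ) ≤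
    2 exp(−Nδ²/(2C²))` (Hoeffding), the quantitative "stable convergence";
  - **`not_isTightMeasureSet_mcEstimate`** / **`not_tendstoInDistribution_mcEstimate`**: case 3 — if `f²/g ∉ L¹(simplex)` (`V(f,g) = ∞`) then
    for NO centring `c_N` are the laws of `√N (estimate_N − c_N)` tight, and they converge in distribution to NO real random variable: there is
    no error law at the scale `C/√N` ("slower than C/√N"), Gaussian or otherwise (a finite variance is necessary — Kallenberg Thm 5.17 /
    Feller XVII.5 / Durrett Ex. 3.4.3 as typed in `Probability/HeavyTails/CentralLimitNecessity`).
NOT typed here: "unstable" / "stabilization" (§III.D's techniques) and any RATE in case 3 beyond non-tightness at scale `√N` (a rate needs a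
tail hypothesis on `f/g`, cf. `Volkov2017/DominatedToyDivergence` for the toy and `Probability/HeavyTails/*` for regularly varying tails); that
`N` independent RUNS produce an i.i.d. stream (taken as the hypotheses `iIndepFun` / `IdentDistrib` / `HasLaw`, one run being §4); the joint
law of Generation part 1's loop with its uniform numbers (hypothesis `hlaw` of §4 is the printed specification "with the probability P[…]",
"using the uniform distribution"); pseudo-randomness; anything about WHICH case a given Feynman-parametric integrand falls in (Volkov: "the
optimal realistic selection is usually somewhere in case 2"; "there is no mathematical proof that (17) does not lead to case 3" — OPEN in print).
-/

namespace Literature.MathematicalPhysics.QuantumFieldTheory.Volkov2017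

open MeasureTheory ProbabilityTheory Set Real
open Borinsky2020

variable {m : ℕ}

/-! ### §1 Measurability of the printed objects (`g₀`, `g`, the generated point) — needed to speak of laws -/

/-- The sector formula (16) is a measurable function of `z` (finite products, ratios and real powers of coordinates).
[cite: Volkov2017, §III.B eq. (16) `eq_mc_g0`] -/
theorem measurable_g0Fund (D : Fin (m + 1) → ℝ) : Measurable (g0Fund D) := by
  have hc : ∀ j : Fin (m + 2), Measurable fun z : Fin (m + 2) → ℝ => z j := fun j => measurable_pi_apply j
  unfold g0Fund
  exact Measurable.div (Finset.measurable_fun_prod _ fun i _ => ((hc _).div (hc _)).pow_const _)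
    (Finset.measurable_fun_prod _ fun j _ => hc j)

/-- The decreasing-sort permutation has measurable level sets: `{z | σ(z) = σ}` is cut out by finitely many coordinate (in)equalities
(Mathlib's `Tuple.eq_sort_iff`: the sort is the lexicographically least monotone rearrangement).
[cite: Volkov2017, §III.B (tex l.572–583: "All the space ℝⁿ is split into sectors. Each sector corresponds to a permutation")] -/
theorem measurableSet_sectorPerm_eq (σ : Equiv.Perm (Fin (m + 2))) :
    MeasurableSet {z : Fin (m + 2) → ℝ | sectorPerm z = σ} := by
  have hc : ∀ j : Fin (m + 2), Measurable fun z : Fin (m + 2) → ℝ => z j := fun j => measurable_pi_apply j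
  set τ : Equiv.Perm (Fin (m + 2)) := σ * Fin.revPerm⁻¹ with hτ
  have hset : {z : Fin (m + 2) → ℝ | sectorPerm z = σ} =
      {z | ∀ i j : Fin (m + 2), i ≤ j → z (τ i) ≤ z (τ j)} ∩
        {z | ∀ i j : Fin (m + 2), i < j → z (τ i) = z (τ j) → τ i < τ j} := by
    ext z
    simp only [mem_setOf_eq, mem_inter_iff]
    have h1 : sectorPerm z = σ ↔ τ = Tuple.sort z := by
      rw [hτ, sectorPerm, eq_comm (a := σ * Fin.revPerm⁻¹), eq_mul_inv_iff_mul_eq]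
    rw [h1, Tuple.eq_sort_iff]
    rfl
  rw [hset]
  refine MeasurableSet.inter ?_ ?_
  · have h : {z : Fin (m + 2) → ℝ | ∀ i j : Fin (m + 2), i ≤ j → z (τ i) ≤ z (τ j)} =
        ⋂ i : Fin (m + 2), ⋂ j : Fin (m + 2), {z | i ≤ j → z (τ i) ≤ z (τ j)} := by
      ext z; simp only [mem_setOf_eq, mem_iInter]
    rw [h]
    refine MeasurableSet.iInter fun i => MeasurableSet.iInter fun j => ?_
    by_cases hij : i ≤ j
    · simp only [hij, true_implies]
      exact measurableSet_le (hc _) (hc _)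
    · simp only [hij, false_implies, setOf_true, MeasurableSet.univ]
  · have h : {z : Fin (m + 2) → ℝ | ∀ i j : Fin (m + 2), i < j → z (τ i) = z (τ j) → τ i < τ j} =
        ⋂ i : Fin (m + 2), ⋂ j : Fin (m + 2), {z | i < j → z (τ i) = z (τ j) → τ i < τ j} := by
      ext z; simp only [mem_setOf_eq, mem_iInter]
    rw [h]
    refine MeasurableSet.iInter fun i => MeasurableSet.iInter fun j => ?_
    by_cases hij : i < j
    · by_cases hτij : τ i < τ j
      · simp only [hij, hτij, implies_true, setOf_true, MeasurableSet.univ]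
      · simp only [hij, hτij, true_implies, imp_false]
        exact (measurableSet_eq_fun (hc _) (hc _)).compl
    · simp only [hij, false_implies, setOf_true, MeasurableSet.univ]

/-- `g0Simplex` written as a finite sum over the sectors of indicator-weighted sector formulas.
[cite: Volkov2017, §III.B eq. (16) `eq_mc_g0`] -/
theorem g0Simplex_eq_sum_ite [DecidableEq (Equiv.Perm (Fin (m + 2)))] (Deg : Finset (Fin (m + 2)) → ℝ)
    (z : Fin (m + 2) → ℝ) :
    g0Simplex Deg z = ∑ σ : Equiv.Perm (Fin (m + 2)),
      if sectorPerm z = σ then g0Fund (tailDeg Deg σ) (z ∘ ⇑σ) else 0 := by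
  rw [Finset.sum_ite_eq Finset.univ (sectorPerm z) (fun σ => g0Fund (tailDeg Deg σ) (z ∘ ⇑σ))]
  simp only [Finset.mem_univ, if_true]
  rfl

/-- **(16) on the whole orthant is a measurable function.** [cite: Volkov2017, §III.B eq. (16) `eq_mc_g0`] -/
theorem measurable_g0Simplex (Deg : Finset (Fin (m + 2)) → ℝ) : Measurable (g0Simplex (m := m) Deg) := by
  classical
  have h : g0Simplex (m := m) Deg = fun z => ∑ σ : Equiv.Perm (Fin (m + 2)),
      if sectorPerm z = σ then g0Fund (tailDeg Deg σ) (z ∘ ⇑σ) else 0 := funext (g0Simplex_eq_sum_ite Deg)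
  rw [h]
  refine Finset.measurable_fun_sum _ fun σ _ => Measurable.ite (measurableSet_sectorPerm_eq σ) ?_ measurable_const
  exact (measurable_g0Fund _).comp (measurable_pi_lambda _ fun i => measurable_pi_apply _)

/-- The chart map `x ↦ (1 − Σ x, x)` is measurable. [cite: Volkov2017, §III.C eq. (19) (the δ-function resolved in z₁)] -/
theorem measurable_simplexPoint : Measurable (simplexPoint : (Fin (m + 1) → ℝ) → Fin (m + 2) → ℝ) := by
  refine measurable_pi_lambda _ fun j => ?_
  refine Fin.cases ?_ (fun i => ?_) j
  · simp only [simplexPoint_zero]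
    exact measurable_const.sub (Finset.measurable_fun_sum _ fun i _ => measurable_pi_apply i)
  · simp only [simplexPoint_succ]
    exact measurable_pi_apply i

/-- **The sampling density `g` is measurable** (so that laws, expectations and variances of `f/g` are meaningful in Mathlib's sense).
[cite: Volkov2017, §III.B (tex l.594–599, "The probability density function is defined by g = g₀/∫g₀")] -/
theorem measurable_samplingDensity (Deg : Finset (Fin (m + 2)) → ℝ) : Measurable (samplingDensity (m := m) Deg) :=
  ((measurable_g0Simplex Deg).comp measurable_simplexPoint).div_const _

/-- The power map `r ↦ r^{E}` of Generation part 2 is measurable. [cite: Volkov2017, §III.C Generation part 2 ("Put t_l = r_l^{1/Deg}")] -/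
theorem measurable_rpowVec (E : Fin (m + 1) → ℝ) : Measurable (rpowVec E) :=
  measurable_pi_lambda _ fun k => (measurable_pi_apply k).pow_const _

/-- "y₁ = 1, y_l = t₂⋯t_l, then (21)" is a measurable map of the sector variables.
[cite: Volkov2017, §III.C Generation part 2 (tex l.1005–1006)] -/
theorem measurable_pointFromSectorVars : Measurable (pointFromSectorVars : (Fin (m + 1) → ℝ) → Fin (m + 1) → ℝ) := by
  have hh : Measurable (heppMap : (Fin (m + 1) → ℝ) → Fin (m + 1) → ℝ) :=
    measurable_pi_lambda _ fun i => Finset.measurable_fun_prod _ fun j _ => measurable_pi_apply j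
  have hy : Measurable fun t : Fin (m + 1) → ℝ => heppMap t ∘ Fin.rev :=
    measurable_pi_lambda _ fun i => (measurable_pi_apply (Fin.rev i)).comp hh
  have hms : Measurable (maxToSum : (Fin (m + 1) → ℝ) → Fin (m + 1) → ℝ) := by
    refine measurable_pi_lambda _ fun i => ?_
    simp only [maxToSum_apply]
    exact (measurable_pi_apply i).div (measurable_const.add (Finset.measurable_fun_sum _ fun j _ => measurable_pi_apply j))
  exact hms.comp hy

/-- **The output of Generation part 2 (sector `σ`) is a measurable function of the uniform input `r`.**
[cite: Volkov2017, §III.C "The algorithm", Generation part 2 (tex l.999–1006)] -/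
theorem measurable_genPointSector (Deg : Finset (Fin (m + 2)) → ℝ) (σ : Equiv.Perm (Fin (m + 2))) :
    Measurable (genPointSector Deg σ) :=
  (measurePreserving_chartPerm σ⁻¹).measurable.comp (measurable_pointFromSectorVars.comp (measurable_rpowVec _))

/-! ### §2 The law of the algorithm's output as a probability MEASURE on the chart: `g(x) dx` on the open simplex -/

/-- **The output law** of the printed algorithm, as a measure on the chart `ℝ^{n−1} ∋ x = (z₂,…,z_n)`: Lebesgue measure restricted to
the open simplex `{z > 0, Σ z = 1}` (chart `simplexChart`) with density `g = g₀/Σ_{a∈Λ} W(Λ∖{a})` — "we take randomly N samples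
x₁,…,x_N with the distribution g". [cite: Volkov2017, §III.A (tex l.491–500) with §III.B (tex l.594–599)] -/
noncomputable def outputLaw (Deg : Finset (Fin (m + 2)) → ℝ) : Measure (Fin (m + 1) → ℝ) :=
  (volume.restrict (simplexChart m)).withDensity fun x => ENNReal.ofReal (samplingDensity Deg x)

/-- Unfolding. [cite: Volkov2017, §III.A–B (the distribution g)] -/
theorem outputLaw_eq (Deg : Finset (Fin (m + 2)) → ℝ) :
    outputLaw Deg = (volume.restrict (simplexChart m)).withDensity fun x => ENNReal.ofReal (samplingDensity Deg x) := rfl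

/-- The mass of a measurable set: `∫_{A ∩ simplex} g`. [cite: Volkov2017, §III.A–B (the distribution g)] -/
theorem outputLaw_apply (Deg : Finset (Fin (m + 2)) → ℝ) {A : Set (Fin (m + 1) → ℝ)} (hA : MeasurableSet A) :
    outputLaw Deg A = ∫⁻ x in A ∩ simplexChart m, ENNReal.ofReal (samplingDensity Deg x) := by
  rw [outputLaw, withDensity_apply _ hA, Measure.restrict_restrict hA]

/-- `g` is integrable over the simplex (its integral is the non-zero number `1`).
[cite: Volkov2017, §III.B (tex l.565–569: "g must satisfy the condition ∫ g δ(Σz−1) dz = 1")] -/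
theorem integrableOn_samplingDensity {Deg : Finset (Fin (m + 2)) → ℝ}
    (hDeg : ∀ s : Finset (Fin (m + 2)), s.Nonempty → s ⊂ Finset.univ → 0 < Deg s) :
    IntegrableOn (samplingDensity Deg) (simplexChart m) := by
  by_contra h
  have h1 := integral_samplingDensity (m := m) hDeg
  rw [integral_undef h] at h1
  exact zero_ne_one h1

/-- The output law is a probability measure ("∫ g = 1"). [cite: Volkov2017, §III.A (tex l.491–494: "∫_Ω g(x) dx = 1")] -/
theorem isProbabilityMeasure_outputLaw {Deg : Finset (Fin (m + 2)) → ℝ}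
    (hDeg : ∀ s : Finset (Fin (m + 2)), s.Nonempty → s ⊂ Finset.univ → 0 < Deg s) :
    IsProbabilityMeasure (outputLaw (m := m) Deg) := by
  refine ⟨?_⟩
  rw [outputLaw_apply Deg MeasurableSet.univ, univ_inter,
    ← ofReal_integral_eq_lintegral_ofReal (integrableOn_samplingDensity hDeg)
      (ae_restrict_of_forall_mem measurableSet_simplexChart fun x hx => (samplingDensity_pos hDeg hx).le),
    integral_samplingDensity hDeg, ENNReal.ofReal_one]

/-- **Expectation under the output law = `∫_{simplex} g·φ`** (every Banach-valued `φ`; both sides are junk together when `g φ` is not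
integrable). [cite: Volkov2017, §III.A (tex l.491–500, sampling "with the distribution g")] -/
theorem integral_outputLaw {F : Type*} [NormedAddCommGroup F] [NormedSpace ℝ F] {Deg : Finset (Fin (m + 2)) → ℝ}
    (hDeg : ∀ s : Finset (Fin (m + 2)), s.Nonempty → s ⊂ Finset.univ → 0 < Deg s) (φ : (Fin (m + 1) → ℝ) → F) :
    ∫ x, φ x ∂outputLaw Deg = ∫ x in simplexChart m, samplingDensity Deg x • φ x := by
  rw [outputLaw, integral_withDensity_eq_integral_toReal_smul
    ((measurable_samplingDensity Deg).ennreal_ofReal) (Filter.Eventually.of_forall fun _ => ENNReal.ofReal_lt_top)]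
  refine setIntegral_congr_fun measurableSet_simplexChart fun x hx => ?_
  rw [ENNReal.toReal_ofReal (samplingDensity_pos hDeg hx).le]

/-- Integrability under the output law = integrability of `g·φ` over the simplex. [cite: Volkov2017, §III.A (tex l.491–500)] -/
theorem integrable_outputLaw_iff {F : Type*} [NormedAddCommGroup F] [NormedSpace ℝ F] {Deg : Finset (Fin (m + 2)) → ℝ}
    (hDeg : ∀ s : Finset (Fin (m + 2)), s.Nonempty → s ⊂ Finset.univ → 0 < Deg s) (φ : (Fin (m + 1) → ℝ) → F) :
    Integrable φ (outputLaw Deg) ↔ IntegrableOn (fun x => samplingDensity Deg x • φ x) (simplexChart m) := by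
  rw [outputLaw, integrable_withDensity_iff_integrable_smul' ((measurable_samplingDensity Deg).ennreal_ofReal)
    (Filter.Eventually.of_forall fun _ => ENNReal.ofReal_lt_top), IntegrableOn]
  refine integrable_congr ?_
  filter_upwards [ae_restrict_mem measurableSet_simplexChart] with x hx
  simp only [ENNReal.toReal_ofReal (samplingDensity_pos hDeg hx).le]

/-- The output law lives on the open simplex chart. [cite: Volkov2017, §III.A–B (g is a density on {z > 0, Σ z = 1})] -/
theorem ae_mem_simplexChart_outputLaw (Deg : Finset (Fin (m + 2)) → ℝ) :
    ∀ᵐ x ∂outputLaw (m := m) Deg, x ∈ simplexChart m :=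
  (withDensity_absolutelyContinuous _ _).ae_le (ae_restrict_mem measurableSet_simplexChart)

/-! ### §3 The importance-sampling weight `f/g` under the output law: mean `∫ f`, second moment `∫ f²/g`, variance `V(f,g)` -/

/-- **The weight of one draw**, `f(x)/g(x)` ("approximate the needed integral by (1/N) Σ_j f(x_j)/g(x_j)").
[cite: Volkov2017, §III.A (tex l.496–500)] -/
noncomputable def weight (Deg : Finset (Fin (m + 2)) → ℝ) (f : (Fin (m + 1) → ℝ) → ℝ) (x : Fin (m + 1) → ℝ) : ℝ :=
  f x / samplingDensity Deg x

/-- Unfolding. [cite: Volkov2017, §III.A (tex l.496–500)] -/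
theorem weight_apply (Deg : Finset (Fin (m + 2)) → ℝ) (f : (Fin (m + 1) → ℝ) → ℝ) (x : Fin (m + 1) → ℝ) :
    weight Deg f x = f x / samplingDensity Deg x := rfl

/-- The weight is measurable when `f` is. [cite: Volkov2017, §III.A (tex l.496–500)] -/
theorem measurable_weight (Deg : Finset (Fin (m + 2)) → ℝ) {f : (Fin (m + 1) → ℝ) → ℝ} (hf : Measurable f) :
    Measurable (weight Deg f) :=
  hf.div (measurable_samplingDensity Deg)

/-- **`V(f,g) = ∫_Ω f(x)²/g(x) dx − (∫_Ω f(x) dx)²`**, the printed variance functional of eq. (13), with `Ω` = the open simplex (read in the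
chart) and `g` = the algorithm's density. [cite: Volkov2017, §III.A eq. (13) `eq_sigma` and the display after it (tex l.501–511)] -/
noncomputable def samplingVariance (Deg : Finset (Fin (m + 2)) → ℝ) (f : (Fin (m + 1) → ℝ) → ℝ) : ℝ :=
  (∫ x in simplexChart m, f x ^ 2 / samplingDensity Deg x) - (∫ x in simplexChart m, f x) ^ 2

/-- Unfolding. [cite: Volkov2017, §III.A eq. (13) (tex l.501–511)] -/
theorem samplingVariance_eq (Deg : Finset (Fin (m + 2)) → ℝ) (f : (Fin (m + 1) → ℝ) → ℝ) :
    samplingVariance Deg f = (∫ x in simplexChart m, f x ^ 2 / samplingDensity Deg x) - (∫ x in simplexChart m, f x) ^ 2 :=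
  rfl

/-- **Mean of the weight = the wanted integral**: `E_g[f/g] = ∫_{simplex} f` (both sides junk together when `f` is not integrable).
[cite: Volkov2017, §III.A (tex l.491–500)] -/
theorem integral_weight {Deg : Finset (Fin (m + 2)) → ℝ}
    (hDeg : ∀ s : Finset (Fin (m + 2)), s.Nonempty → s ⊂ Finset.univ → 0 < Deg s) (f : (Fin (m + 1) → ℝ) → ℝ) :
    ∫ x, weight Deg f x ∂outputLaw Deg = ∫ x in simplexChart m, f x := by
  rw [integral_outputLaw hDeg]
  refine setIntegral_congr_fun measurableSet_simplexChart fun x hx => ?_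
  rw [weight_apply, smul_eq_mul, mul_div_cancel₀ _ (samplingDensity_pos hDeg hx).ne']

/-- Integrability of the weight under the law = integrability of `f` over the simplex ("finite mean").
[cite: Volkov2017, §III.A (tex l.491–500)] -/
theorem integrable_weight_iff {Deg : Finset (Fin (m + 2)) → ℝ}
    (hDeg : ∀ s : Finset (Fin (m + 2)), s.Nonempty → s ⊂ Finset.univ → 0 < Deg s) (f : (Fin (m + 1) → ℝ) → ℝ) :
    Integrable (weight Deg f) (outputLaw Deg) ↔ IntegrableOn f (simplexChart m) := by
  rw [integrable_outputLaw_iff hDeg]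
  refine integrableOn_congr_fun (fun x hx => ?_) measurableSet_simplexChart
  rw [weight_apply, smul_eq_mul, mul_div_cancel₀ _ (samplingDensity_pos hDeg hx).ne']

/-- **Second moment of the weight = `∫ f²/g`**, the first integral of the printed `V(f,g)` (both sides junk together when `f²/g` is
not integrable). [cite: Volkov2017, §III.A eq. (13) and the display after it (tex l.501–511)] -/
theorem integral_weight_sq {Deg : Finset (Fin (m + 2)) → ℝ}
    (hDeg : ∀ s : Finset (Fin (m + 2)), s.Nonempty → s ⊂ Finset.univ → 0 < Deg s) (f : (Fin (m + 1) → ℝ) → ℝ) :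
    ∫ x, weight Deg f x ^ 2 ∂outputLaw Deg = ∫ x in simplexChart m, f x ^ 2 / samplingDensity Deg x := by
  rw [integral_outputLaw hDeg]
  refine setIntegral_congr_fun measurableSet_simplexChart fun x hx => ?_
  rw [weight_apply, smul_eq_mul]
  field_simp [(samplingDensity_pos hDeg hx).ne']

/-- Integrability of the squared weight under the law = integrability of `f²/g` over the simplex ("`V(f,g)` finite").
[cite: Volkov2017, §III.A eq. (13) (tex l.501–511)] -/
theorem integrable_weight_sq_iff {Deg : Finset (Fin (m + 2)) → ℝ}
    (hDeg : ∀ s : Finset (Fin (m + 2)), s.Nonempty → s ⊂ Finset.univ → 0 < Deg s) (f : (Fin (m + 1) → ℝ) → ℝ) :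
    Integrable (fun x => weight Deg f x ^ 2) (outputLaw Deg) ↔
      IntegrableOn (fun x => f x ^ 2 / samplingDensity Deg x) (simplexChart m) := by
  rw [integrable_outputLaw_iff hDeg]
  refine integrableOn_congr_fun (fun x hx => ?_) measurableSet_simplexChart
  rw [weight_apply, smul_eq_mul]
  field_simp [(samplingDensity_pos hDeg hx).ne']

/-- `f/g ∈ L²(g)` iff `f²/g` is integrable over the simplex (for measurable `f`). [cite: Volkov2017, §III.A eq. (13) (tex l.501–511)] -/
theorem memLp_two_weight_iff {Deg : Finset (Fin (m + 2)) → ℝ}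
    (hDeg : ∀ s : Finset (Fin (m + 2)), s.Nonempty → s ⊂ Finset.univ → 0 < Deg s) {f : (Fin (m + 1) → ℝ) → ℝ}
    (hf : Measurable f) :
    MemLp (weight Deg f) 2 (outputLaw Deg) ↔ IntegrableOn (fun x => f x ^ 2 / samplingDensity Deg x) (simplexChart m) := by
  rw [memLp_two_iff_integrable_sq (measurable_weight Deg hf).aestronglyMeasurable, integrable_weight_sq_iff hDeg]

/-- **Finite `V(f,g)` forces a finite mean**: if `f²/g` is integrable over the simplex then so is `f` (pointwise
`|f| ≤ (f²/g + g)/2` and `∫ g = 1`). [cite: Volkov2017, §III.A eq. (13) (tex l.501–511)] -/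
theorem integrableOn_of_integrableOn_sq_div {Deg : Finset (Fin (m + 2)) → ℝ}
    (hDeg : ∀ s : Finset (Fin (m + 2)), s.Nonempty → s ⊂ Finset.univ → 0 < Deg s) {f : (Fin (m + 1) → ℝ) → ℝ}
    (hf : Measurable f) (h2 : IntegrableOn (fun x => f x ^ 2 / samplingDensity Deg x) (simplexChart m)) :
    IntegrableOn f (simplexChart m) := by
  have hb : IntegrableOn (fun x => (f x ^ 2 / samplingDensity Deg x + samplingDensity Deg x) / 2) (simplexChart m) :=
    (h2.add (integrableOn_samplingDensity hDeg)).div_const 2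
  refine Integrable.mono' hb hf.aestronglyMeasurable (ae_restrict_of_forall_mem measurableSet_simplexChart fun x hx => ?_)
  have hg := samplingDensity_pos hDeg hx
  rw [Real.norm_eq_abs]
  -- `(|f| − g)² ≥ 0` divided by `g > 0`
  have hkey : 0 ≤ (f x ^ 2 / samplingDensity Deg x + samplingDensity Deg x) / 2 - |f x| := by
    have h1 : (f x ^ 2 / samplingDensity Deg x + samplingDensity Deg x) / 2 - |f x| =
        (|f x| - samplingDensity Deg x) ^ 2 / (2 * samplingDensity Deg x) := by
      field_simp
      rw [← sq_abs (f x)]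
      ring
    rw [h1]
    positivity
  linarith

/-- **`V(f,g)` IS the variance of one draw's weight under the algorithm's law**: for measurable `f` with `f²/g` integrable over the
simplex, `Var_g[f/g] = ∫ f²/g − (∫ f)² = V(f,g)`. [cite: Volkov2017, §III.A eq. (13) `eq_sigma` and the display after it (tex l.501–511)] -/
theorem variance_weight {Deg : Finset (Fin (m + 2)) → ℝ}
    (hDeg : ∀ s : Finset (Fin (m + 2)), s.Nonempty → s ⊂ Finset.univ → 0 < Deg s) {f : (Fin (m + 1) → ℝ) → ℝ}
    (hf : Measurable f) (h2 : IntegrableOn (fun x => f x ^ 2 / samplingDensity Deg x) (simplexChart m)) :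
    Var[weight Deg f; outputLaw Deg] = samplingVariance Deg f := by
  haveI := isProbabilityMeasure_outputLaw (m := m) hDeg
  rw [variance_eq_sub ((memLp_two_weight_iff hDeg hf).2 h2), samplingVariance_eq]
  simp only [Pi.pow_apply]
  rw [integral_weight_sq hDeg, integral_weight hDeg]

/-! ### §4 The printed algorithm REALISES this law: sector by Generation part 1, point by Generation part 2 ⇒ output `∼ g` -/

/-- The uniform numbers `r₂,…,r_n` live on a box of volume one. [cite: Volkov2017, §III.C Generation part 2 ("Generate r₂,…,r_n ∈ [0;1]
using the uniform distribution")] -/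
theorem volume_heppUnitBox : volume (heppUnitBox m) = 1 := by
  rw [heppUnitBox_eq_pi, volume_pi_pi]
  simp [Real.volume_Ioc]

/-- Hence "uniform on the box" (Lebesgue measure restricted to it) is a probability law. [cite: Volkov2017, §III.C Generation part 2] -/
theorem isProbabilityMeasure_volume_restrict_heppUnitBox :
    IsProbabilityMeasure (volume.restrict (heppUnitBox m) : Measure (Fin (m + 1) → ℝ)) :=
  ⟨by rw [Measure.restrict_apply_univ, volume_heppUnitBox]⟩

/-- Generation part 1 gives every sector positive probability (`genProb(σ) = 1/(∏ Deg · Σ_a W(Λ∖{a}))`).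
[cite: Volkov2017, §III.C eq. (24) `eq_next_prob` and Generation part 1 (tex l.993–998)] -/
theorem genProb_ofFn_pos {Deg : Finset (Fin (m + 2)) → ℝ}
    (hDeg : ∀ s : Finset (Fin (m + 2)), s.Nonempty → s ⊂ Finset.univ → 0 < Deg s) (σ : Equiv.Perm (Fin (m + 2))) :
    0 < genProb Deg Finset.univ (List.ofFn ⇑σ) := by
  have hprod : 0 < ∏ i, tailDeg Deg σ i := Finset.prod_pos fun i _ => tailDeg_pos hDeg σ i
  have h := genProb_mul_prod_tailDeg hDeg σ
  have hpos : 0 < genProb Deg Finset.univ (List.ofFn ⇑σ) * ∏ i, tailDeg Deg σ i := by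
    rw [h]
    exact inv_pos.mpr (totalW_pos Finset.univ_nonempty hDeg)
  exact (pos_iff_pos_of_mul_pos hpos).mpr hprod

/-- **THE PRINTED ALGORITHM SAMPLES `g` — in Mathlib's vocabulary (`HasLaw`).** On any probability space let `S` be the sector drawn by
Generation part 1 and `r` the uniform numbers of Generation part 2, with the printed joint law
`P(S = σ, r ∈ B) = P[Λ,…]-probability(σ) · Unif_{(0,1]^{n−1}}(B)` (the loop's law `genProb`, eq. (24), times the independent uniform
`r₂,…,r_n`); then the returned point `z` (read in the chart) HAS LAW `g(x) dx` on the simplex: `P ∘ (ω ↦ genPointSector (S ω) (r ω))⁻¹ =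
outputLaw`. This is the measure form of `GenerationAlgorithmLaw.sum_genProb_smul_integral_comp_genPointSector` (tested on indicators).
[cite: Volkov2017, §III.C "The algorithm" (tex l.984–1008) with §III.B (tex l.594–599)] -/
theorem hasLaw_genPointSector {Ω : Type*} [MeasurableSpace Ω] {P : Measure Ω} {Deg : Finset (Fin (m + 2)) → ℝ}
    (hDeg : ∀ s : Finset (Fin (m + 2)), s.Nonempty → s ⊂ Finset.univ → 0 < Deg s)
    {S : Ω → Equiv.Perm (Fin (m + 2))} {r : Ω → (Fin (m + 1) → ℝ)} (hS : ∀ σ, MeasurableSet (S ⁻¹' {σ})) (hr : Measurable r)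
    (hlaw : ∀ (σ : Equiv.Perm (Fin (m + 2))) (B : Set (Fin (m + 1) → ℝ)), MeasurableSet B →
      P (S ⁻¹' {σ} ∩ r ⁻¹' B) = ENNReal.ofReal (genProb Deg Finset.univ (List.ofFn ⇑σ)) * volume.restrict (heppUnitBox m) B) :
    HasLaw (fun ω => genPointSector Deg (S ω) (r ω)) (outputLaw Deg) P := by
  classical
  -- the preimage of a set splits along the (finitely many) values of the sector
  have hpre : ∀ A : Set (Fin (m + 1) → ℝ), (fun ω => genPointSector Deg (S ω) (r ω)) ⁻¹' A =
      ⋃ σ, S ⁻¹' {σ} ∩ r ⁻¹' (genPointSector Deg σ ⁻¹' A) := fun A => by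
    ext ω
    simp only [mem_preimage, mem_iUnion, mem_inter_iff, mem_singleton_iff]
    constructor
    · intro h
      exact ⟨S ω, rfl, h⟩
    · rintro ⟨σ, hσ, h⟩
      rw [hσ]
      exact h
  have hmeasσ : ∀ (σ : Equiv.Perm (Fin (m + 2))) {A : Set (Fin (m + 1) → ℝ)}, MeasurableSet A →
      MeasurableSet (S ⁻¹' {σ} ∩ r ⁻¹' (genPointSector Deg σ ⁻¹' A)) := fun σ A hA =>
    (hS σ).inter (hr (measurable_genPointSector Deg σ hA))
  have hmeas : Measurable fun ω => genPointSector Deg (S ω) (r ω) := by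
    intro A hA
    rw [hpre A]
    exact MeasurableSet.iUnion fun σ => hmeasσ σ hA
  have hdisj : ∀ A : Set (Fin (m + 1) → ℝ),
      Pairwise (Function.onFun Disjoint fun σ => S ⁻¹' {σ} ∩ r ⁻¹' (genPointSector Deg σ ⁻¹' A)) := fun A σ τ hne =>
    Set.disjoint_left.mpr fun ω h1 h2 => hne (h1.1.symm.trans h2.1)
  haveI := isProbabilityMeasure_volume_restrict_heppUnitBox (m := m)
  -- `g₀ ∘ z` is integrable over the simplex (its integral is `Σ_a W(Λ∖{a}) ≠ 0`)
  have hG : IntegrableOn (fun x => g0Simplex Deg (simplexPoint x)) (simplexChart m) := by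
    by_contra h
    have h1 := integral_simplexChart_g0Simplex (m := m) hDeg
    rw [integral_undef h] at h1
    exact (totalW_pos Finset.univ_nonempty hDeg).ne' h1.symm
  refine ⟨hmeas.aemeasurable, Measure.ext fun A hA => ?_⟩
  rw [Measure.map_apply hmeas hA, hpre A, measure_iUnion (hdisj A) (fun σ => hmeasσ σ hA), tsum_fintype,
    outputLaw_apply Deg hA]
  rw [Finset.sum_congr rfl fun σ _ => hlaw σ _ (measurable_genPointSector Deg σ hA)]
  -- the real identity behind it: the algorithm's law tested on the indicator of `A`
  have hφ : IntegrableOn (fun x => g0Simplex Deg (simplexPoint x) • A.indicator (fun _ => (1 : ℝ)) x) (simplexChart m) := by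
    refine (hG.indicator hA).congr_fun (fun x _ => ?_) measurableSet_simplexChart
    by_cases hx : x ∈ A <;> simp [hx]
  have key := sum_genProb_smul_integral_comp_genPointSector hDeg (fun x => A.indicator (fun _ => (1 : ℝ)) x) hφ
  have hL : ∀ σ : Equiv.Perm (Fin (m + 2)), ∫ y in heppUnitBox m, A.indicator (fun _ => (1 : ℝ)) (genPointSector Deg σ y) =
      (volume.restrict (heppUnitBox m)).real (genPointSector Deg σ ⁻¹' A) := fun σ => by
    rw [← integral_indicator_one ((measurable_genPointSector Deg σ) hA)]
    rfl
  have hR : ∫ x in simplexChart m, (g0Simplex Deg (simplexPoint x) / totalW Deg Finset.univ) • A.indicator (fun _ => (1 : ℝ)) x =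
      ∫ x in A ∩ simplexChart m, samplingDensity Deg x := by
    rw [← Measure.restrict_restrict hA, ← integral_indicator hA]
    refine integral_congr_ae (Filter.Eventually.of_forall fun x => ?_)
    by_cases hx : x ∈ A <;> simp [hx, samplingDensity_eq]
  rw [hR] at key
  simp only [hL, smul_eq_mul] at key
  -- pass to `ℝ≥0∞`
  have hintA : IntegrableOn (samplingDensity Deg) (A ∩ simplexChart m) :=
    (integrableOn_samplingDensity hDeg).mono_set inter_subset_right
  have hnnA : 0 ≤ᵐ[volume.restrict (A ∩ simplexChart m)] samplingDensity Deg :=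
    ae_restrict_of_forall_mem (hA.inter measurableSet_simplexChart) fun x hx => (samplingDensity_pos hDeg hx.2).le
  rw [← ofReal_integral_eq_lintegral_ofReal hintA hnnA, ← key,
    ENNReal.ofReal_sum_of_nonneg fun σ _ => mul_nonneg (genProb_ofFn_pos hDeg σ).le measureReal_nonneg]
  refine Finset.sum_congr rfl fun σ _ => ?_
  rw [ENNReal.ofReal_mul (genProb_ofFn_pos hDeg σ).le, ofReal_measureReal (measure_ne_top _ _)]

/-! ### §5 `N` samples: the estimate `(1/N) Σ_j f(x_j)/g(x_j)`, its standard deviation `σ = √(V(f,g)/N)` (eq. (13)), and the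
three cases of §III.A as theorems (via the i.i.d. theory typed in `Borinsky2020/TropicalSamplingEstimator` and
`Probability/HeavyTails/CentralLimitNecessity`) -/

section Samples

variable {Ω : Type*} {mΩ : MeasurableSpace Ω} {P : Measure Ω} {Deg : Finset (Fin (m + 2)) → ℝ} {f : (Fin (m + 1) → ℝ) → ℝ}
  {x : ℕ → Ω → (Fin (m + 1) → ℝ)}

/-- **The Monte Carlo estimate after `N` samples**: `(1/N) Σ_{j=1}^{N} f(x_j)/g(x_j)` for a sample stream `x : ℕ → Ω → chart`
(indexing `j < N`; at `N = 0` the junk value `0`). [cite: Volkov2017, §III.A (tex l.491–500: "we take randomly N samples x₁,…,x_N with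
the distribution g and approximate the needed integral by (1/N) Σ_{j=1}^N f(x_j)/g(x_j)")] -/
noncomputable def mcEstimate (Deg : Finset (Fin (m + 2)) → ℝ) (f : (Fin (m + 1) → ℝ) → ℝ) (x : ℕ → Ω → (Fin (m + 1) → ℝ))
    (N : ℕ) (ω : Ω) : ℝ :=
  (N : ℝ)⁻¹ * ∑ k ∈ Finset.range N, weight Deg f (x k ω)

/-- Unfolding. [cite: Volkov2017, §III.A (tex l.496–500)] -/
theorem mcEstimate_apply (Deg : Finset (Fin (m + 2)) → ℝ) (f : (Fin (m + 1) → ℝ) → ℝ) (x : ℕ → Ω → (Fin (m + 1) → ℝ))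
    (N : ℕ) (ω : Ω) : mcEstimate Deg f x N ω = (N : ℝ)⁻¹ * ∑ k ∈ Finset.range N, weight Deg f (x k ω) := rfl

/-- Volkov's estimate IS Borinsky's Algorithm-2 estimator `I^{(N)}` with `I^tr = 1` and weight `R = f/g` (dictionary to
`Borinsky2020/TropicalSamplingEstimator`). [cite: Volkov2017, §III.A (tex l.496–500)] -/
theorem mcEstimate_eq_tropicalEstimate (Deg : Finset (Fin (m + 2)) → ℝ) (f : (Fin (m + 1) → ℝ) → ℝ)
    (x : ℕ → Ω → (Fin (m + 1) → ℝ)) : mcEstimate Deg f x = tropicalEstimate 1 (weight Deg f) x := by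
  funext N ω
  rw [mcEstimate_apply, tropicalEstimate_def, one_div]

/-- `√N · (estimate_N − c_N) = (√N)⁻¹ Σ_{j<N} f(x_j)/g(x_j) − √N c_N` — the normalised error in the form of the i.i.d. limit theorems
(`N = 0`: both sides are `0`). [cite: Volkov2017, §III.A eq. (13) (the scale `C/√N`)] -/
theorem sqrt_mul_mcEstimate_sub (Deg : Finset (Fin (m + 2)) → ℝ) (f : (Fin (m + 1) → ℝ) → ℝ)
    (x : ℕ → Ω → (Fin (m + 1) → ℝ)) (c : ℕ → ℝ) (N : ℕ) (ω : Ω) :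
    √(N : ℝ) * (mcEstimate Deg f x N ω - c N) =
      (√(N : ℝ))⁻¹ * (∑ k ∈ Finset.range N, (weight Deg f ∘ x k) ω) - √(N : ℝ) * c N := by
  simp only [Function.comp_apply, mcEstimate_apply]
  rcases Nat.eq_zero_or_pos N with hN | hN
  · subst hN
    simp
  · have hkey : √(N : ℝ) * (N : ℝ)⁻¹ = (√(N : ℝ))⁻¹ := by
      rw [← div_eq_mul_inv, Real.sqrt_div_self', one_div]
    rw [mul_sub, ← mul_assoc, hkey]

/-- **The estimate is unbiased**: `E[(1/N) Σ f(x_j)/g(x_j)] = ∫_{simplex} f` for `N ≥ 1`, i.i.d. samples of law `g`, and `f`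
integrable over the simplex. [cite: Volkov2017, §III.A (tex l.491–500)] -/
theorem integral_mcEstimate (hDeg : ∀ s : Finset (Fin (m + 2)), s.Nonempty → s ⊂ Finset.univ → 0 < Deg s)
    (hf : Measurable f) (hlaw : HasLaw (x 0) (outputLaw Deg) P) (hident : ∀ k, IdentDistrib (x k) (x 0) P P)
    (hint : IntegrableOn f (simplexChart m)) {N : ℕ} (hN : N ≠ 0) :
    ∫ ω, mcEstimate Deg f x N ω ∂P = ∫ y in simplexChart m, f y := by
  rw [mcEstimate_eq_tropicalEstimate, integral_tropicalEstimate (measurable_weight Deg hf) hlaw hident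
    ((integrable_weight_iff hDeg f).2 hint) hN 1, one_mul, integral_weight hDeg]

/-- **Eq. (13): "The standard deviation of this value is `σ = √(V(f,g)/N)`"** — variance form: for `N ≥ 1` i.i.d. samples of law
`g` and measurable `f` with `f²/g` integrable over the simplex (cases 1–2), `Var[(1/N) Σ f(x_j)/g(x_j)] = V(f,g)/N`.
[cite: Volkov2017, §III.A eq. (13) `eq_sigma` (tex l.501–511)] -/
theorem variance_mcEstimate (hDeg : ∀ s : Finset (Fin (m + 2)), s.Nonempty → s ⊂ Finset.univ → 0 < Deg s)
    (hf : Measurable f) (hlaw : HasLaw (x 0) (outputLaw Deg) P) (hindep : iIndepFun x P)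
    (hident : ∀ k, IdentDistrib (x k) (x 0) P P)
    (h2 : IntegrableOn (fun y => f y ^ 2 / samplingDensity Deg y) (simplexChart m)) {N : ℕ} (hN : N ≠ 0) :
    Var[mcEstimate Deg f x N; P] = samplingVariance Deg f / N := by
  rw [mcEstimate_eq_tropicalEstimate, variance_tropicalEstimate (measurable_weight Deg hf) hlaw hindep hident
    ((memLp_two_weight_iff hDeg hf).2 h2) hN 1, one_pow, one_mul, variance_weight hDeg hf h2]

/-- **Eq. (13) as printed, `σ = √(V(f,g)/N)`** (`σ` = the standard deviation = the square root of the variance of the `N`-sample estimate).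
[cite: Volkov2017, §III.A eq. (13) `eq_sigma` (tex l.501–511)] -/
theorem sqrt_variance_mcEstimate (hDeg : ∀ s : Finset (Fin (m + 2)), s.Nonempty → s ⊂ Finset.univ → 0 < Deg s)
    (hf : Measurable f) (hlaw : HasLaw (x 0) (outputLaw Deg) P) (hindep : iIndepFun x P)
    (hident : ∀ k, IdentDistrib (x k) (x 0) P P)
    (h2 : IntegrableOn (fun y => f y ^ 2 / samplingDensity Deg y) (simplexChart m)) {N : ℕ} (hN : N ≠ 0) :
    √(Var[mcEstimate Deg f x N; P]) = √(samplingVariance Deg f / N) := by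
  rw [variance_mcEstimate hDeg hf hlaw hindep hident h2 hN]

/-- **"The error can be approximated by (13)" — Chebyshev form**: for `N ≥ 1`, `δ > 0` and `V(f,g) < ∞`,
`P(|estimate − ∫ f| ≥ δ) ≤ V(f,g)/(N δ²) = (σ/δ)²`. [cite: Volkov2017, §III.A eq. (13) and cases 1–2 (tex l.501–528)] -/
theorem measureReal_le_abs_mcEstimate_sub [IsProbabilityMeasure P]
    (hDeg : ∀ s : Finset (Fin (m + 2)), s.Nonempty → s ⊂ Finset.univ → 0 < Deg s)
    (hf : Measurable f) (hlaw : HasLaw (x 0) (outputLaw Deg) P) (hindep : iIndepFun x P)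
    (hident : ∀ k, IdentDistrib (x k) (x 0) P P)
    (h2 : IntegrableOn (fun y => f y ^ 2 / samplingDensity Deg y) (simplexChart m)) {N : ℕ} (hN : N ≠ 0)
    {δ : ℝ} (hδ : 0 < δ) :
    P.real {ω | δ ≤ |mcEstimate Deg f x N ω - ∫ y in simplexChart m, f y|} ≤ samplingVariance Deg f / (N * δ ^ 2) := by
  have h := measureReal_le_abs_tropicalEstimate_sub (measurable_weight Deg hf) hlaw hindep hident
    ((memLp_two_weight_iff hDeg hf).2 h2) hN 1 hδ
  rw [one_mul, integral_weight hDeg, one_pow, one_mul, variance_weight hDeg hf h2, ← mcEstimate_eq_tropicalEstimate] at h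
  exact h

/-- **Convergence in all three cases — it is the MEAN that must be finite**: if `f` is integrable over the simplex (the subtracted
integral converges absolutely) then, whatever `V(f,g)`, the estimate converges to `∫ f` almost surely as `N → ∞` (strong law of large
numbers for the i.i.d. weights). [cite: Volkov2017, §III.A cases 1–3 (tex l.517–532: "convergence", "stable" or "unstable")] -/
theorem ae_tendsto_mcEstimate (hDeg : ∀ s : Finset (Fin (m + 2)), s.Nonempty → s ⊂ Finset.univ → 0 < Deg s)
    (hf : Measurable f) (hlaw : HasLaw (x 0) (outputLaw Deg) P) (hindep : iIndepFun x P)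
    (hident : ∀ k, IdentDistrib (x k) (x 0) P P) (hint : IntegrableOn f (simplexChart m)) :
    ∀ᵐ ω ∂P, Filter.Tendsto (fun N : ℕ => mcEstimate Deg f x N ω) Filter.atTop (nhds (∫ y in simplexChart m, f y)) := by
  have h := ae_tendsto_tropicalEstimate (measurable_weight Deg hf) hlaw hindep hident ((integrable_weight_iff hDeg f).2 hint) 1
  rw [one_mul, integral_weight hDeg, ← mcEstimate_eq_tropicalEstimate] at h
  exact h

/-- **Cases 1–2 ("V(f,g) is finite … the error can be approximated by (13)") as the central limit theorem**: for i.i.d. samples of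
law `g` and `f²/g` integrable over the simplex, `√N · (estimate − ∫ f)` converges in distribution to the centred normal law of variance
`V(f,g)` — so `σ = √(V(f,g)/N)` IS the asymptotic scale of the error. (Mathlib's CLT via `Borinsky2020.tendstoInDistribution_tropicalEstimate`;
`gaussianReal 0 0` = the Dirac mass covers `V = 0`.) [cite: Volkov2017, §III.A eq. (13) and cases 1–2 (tex l.501–528)] -/
theorem tendstoInDistribution_mcEstimate [IsProbabilityMeasure P] {Ω' : Type*} [MeasurableSpace Ω'] {P' : Measure Ω'}
    [IsProbabilityMeasure P'] {Y : Ω' → ℝ}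
    (hDeg : ∀ s : Finset (Fin (m + 2)), s.Nonempty → s ⊂ Finset.univ → 0 < Deg s)
    (hf : Measurable f) (hlaw : HasLaw (x 0) (outputLaw Deg) P) (hindep : iIndepFun x P)
    (hident : ∀ k, IdentDistrib (x k) (x 0) P P)
    (h2 : IntegrableOn (fun y => f y ^ 2 / samplingDensity Deg y) (simplexChart m))
    (hY : HasLaw Y (gaussianReal 0 (samplingVariance Deg f).toNNReal) P') :
    TendstoInDistribution (fun (N : ℕ) ω => √(N : ℝ) * (mcEstimate Deg f x N ω - ∫ y in simplexChart m, f y))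
      Filter.atTop Y (fun _ => P) P' := by
  have hw2 := (memLp_two_weight_iff hDeg hf).2 h2
  rw [← variance_weight hDeg hf h2, ← one_mul (Var[weight Deg f; outputLaw Deg]), ← one_pow 2] at hY
  have h := tendstoInDistribution_tropicalEstimate (measurable_weight Deg hf) hlaw hindep hident hw2 1 hY
  rw [one_mul, integral_weight hDeg, ← mcEstimate_eq_tropicalEstimate] at h
  exact h

/-- **Case 1 ("f/g is bounded … stable Monte Carlo convergence") quantified**: if `|f| ≤ C·g` on the simplex then for every `N ≥ 1`
and `δ ≥ 0`, `P(|estimate − ∫ f| ≥ δ) ≤ 2 exp(−N δ²/(2C²))` (Hoeffding's inequality for the bounded i.i.d. weights, via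
`Borinsky2020.measureReal_le_abs_tropicalEstimate_sub_le_two_mul_exp_of_abs_le`). [cite: Volkov2017, §III.A case 1 (tex l.520–523)] -/
theorem measureReal_le_abs_mcEstimate_sub_le_exp_of_bounded [IsProbabilityMeasure P]
    (hDeg : ∀ s : Finset (Fin (m + 2)), s.Nonempty → s ⊂ Finset.univ → 0 < Deg s)
    (hf : Measurable f) (hlaw : HasLaw (x 0) (outputLaw Deg) P) (hindep : iIndepFun x P)
    (hident : ∀ k, IdentDistrib (x k) (x 0) P P) {C : ℝ} (hC : ∀ y ∈ simplexChart m, |f y| ≤ C * samplingDensity Deg y)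
    {N : ℕ} (hN : N ≠ 0) {δ : ℝ} (hδ : 0 ≤ δ) :
    P.real {ω | δ ≤ |mcEstimate Deg f x N ω - ∫ y in simplexChart m, f y|} ≤ 2 * Real.exp (-(N * δ ^ 2 / (2 * C ^ 2))) := by
  have hC' : ∀ᵐ y ∂outputLaw Deg, |weight Deg f y| ≤ C := by
    filter_upwards [ae_mem_simplexChart_outputLaw (m := m) Deg] with y hy
    have hg := samplingDensity_pos hDeg hy
    rw [weight_apply, abs_div, abs_of_pos hg, div_le_iff₀ hg]
    exact hC y hy
  have h := measureReal_le_abs_tropicalEstimate_sub_le_two_mul_exp_of_abs_le (measurable_weight Deg hf) hlaw hindep hident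
    hC' hN 1 hδ
  rw [one_mul, integral_weight hDeg, one_mul, ← mcEstimate_eq_tropicalEstimate] at h
  exact h

/-- **Case 3 ("V(f,g) is infinite … unstable convergence that is slower than C/√N"), tightness form**: if `f` is measurable and `f²/g` is
NOT integrable over the simplex then for NO centring constants `c_N` is the family of laws of `√N · (estimate_N − c_N)` tight — for
every would-be scale constant the normalised error escapes it with probability bounded below along a subsequence; a finite variance is
NECESSARY for `√N`-tightness (Kallenberg Thm 5.17 / Feller XVII.5, typed as
`Literature.Probability.HeavyTails.not_isTightMeasureSet_of_not_memLp_two`). [cite: Volkov2017, §III.A case 3 (tex l.529–531)] -/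
theorem not_isTightMeasureSet_mcEstimate [IsProbabilityMeasure P]
    (hDeg : ∀ s : Finset (Fin (m + 2)), s.Nonempty → s ⊂ Finset.univ → 0 < Deg s)
    (hf : Measurable f) (hlaw : HasLaw (x 0) (outputLaw Deg) P) (hindep : iIndepFun x P)
    (hident : ∀ k, IdentDistrib (x k) (x 0) P P)
    (h2 : ¬ IntegrableOn (fun y => f y ^ 2 / samplingDensity Deg y) (simplexChart m)) (c : ℕ → ℝ) :
    ¬ IsTightMeasureSet (Set.range fun N : ℕ => P.map fun ω => √(N : ℝ) * (mcEstimate Deg f x N ω - c N)) := by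
  -- the weights `w_k = f(x_k)/g(x_k)` are i.i.d. real random variables with `w₀ ∉ L²`
  have hR := measurable_weight Deg hf
  have hXindep : iIndepFun (fun k => weight Deg f ∘ x k) P := hindep.comp (fun _ => weight Deg f) fun _ => hR
  have hXident : ∀ k, IdentDistrib (weight Deg f ∘ x k) (weight Deg f ∘ x 0) P P := fun k => (hident k).comp hR
  have hX0 : IdentDistrib (weight Deg f ∘ x 0) (weight Deg f) P (outputLaw Deg) := identDistrib_comp_sample hR hlaw hident 0
  have hX2 : ¬ MemLp (weight Deg f ∘ x 0) 2 P := fun h => h2 ((memLp_two_weight_iff hDeg hf).1 (hX0.memLp_iff.1 h))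
  simp only [sqrt_mul_mcEstimate_sub]
  exact Literature.Probability.HeavyTails.not_isTightMeasureSet_of_not_memLp_two hXindep hXident hX2 fun n => √(n : ℝ) * c n

/-- **Case 3, limit form**: with `V(f,g) = ∞` (`f` measurable, `f²/g` not integrable over the simplex), `√N · (estimate_N − c_N)` converges
in distribution to NO real random variable, for NO centring `c_N` — no central limit theorem at the scale `C/√N` of eq. (13), Gaussian or
not (`Literature.Probability.HeavyTails.not_tendstoInDistribution_of_not_memLp_two`). [cite: Volkov2017, §III.A case 3 (tex l.529–531:
"V(f,g) is infinite. In this case, we will have unstable convergence that is slower than C/√N. An adequate error estimation is difficult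
in this case.")] -/
theorem not_tendstoInDistribution_mcEstimate [IsProbabilityMeasure P] {Ω' : Type*} [MeasurableSpace Ω'] {P' : Measure Ω'}
    [IsProbabilityMeasure P'] (Y : Ω' → ℝ)
    (hDeg : ∀ s : Finset (Fin (m + 2)), s.Nonempty → s ⊂ Finset.univ → 0 < Deg s)
    (hf : Measurable f) (hlaw : HasLaw (x 0) (outputLaw Deg) P) (hindep : iIndepFun x P)
    (hident : ∀ k, IdentDistrib (x k) (x 0) P P)
    (h2 : ¬ IntegrableOn (fun y => f y ^ 2 / samplingDensity Deg y) (simplexChart m)) (c : ℕ → ℝ) :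
    ¬ TendstoInDistribution (fun (N : ℕ) ω => √(N : ℝ) * (mcEstimate Deg f x N ω - c N)) Filter.atTop Y (fun _ => P) P' := by
  have hR := measurable_weight Deg hf
  have hXindep : iIndepFun (fun k => weight Deg f ∘ x k) P := hindep.comp (fun _ => weight Deg f) fun _ => hR
  have hXident : ∀ k, IdentDistrib (weight Deg f ∘ x k) (weight Deg f ∘ x 0) P P := fun k => (hident k).comp hR
  have hX0 : IdentDistrib (weight Deg f ∘ x 0) (weight Deg f) P (outputLaw Deg) := identDistrib_comp_sample hR hlaw hident 0
  have hX2 : ¬ MemLp (weight Deg f ∘ x 0) 2 P := fun h => h2 ((memLp_two_weight_iff hDeg hf).1 (hX0.memLp_iff.1 h))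
  have hseq : (fun (N : ℕ) ω => √(N : ℝ) * (mcEstimate Deg f x N ω - c N)) =
      fun (n : ℕ) ω => (√(n : ℝ))⁻¹ * (∑ k ∈ Finset.range n, (weight Deg f ∘ x k) ω) - √(n : ℝ) * c n := by
    funext N ω
    exact sqrt_mul_mcEstimate_sub Deg f x c N ω
  rw [hseq]
  exact Literature.Probability.HeavyTails.not_tendstoInDistribution_of_not_memLp_two Y hXindep hXident hX2 fun n => √(n : ℝ) * c n

end Samples

end Literature.MathematicalPhysics.QuantumFieldTheory.Volkov2017
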